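import Literature.MathematicalPhysics.QuantumLattice.PairFieldCarrierBoundCore
import HarnessLib

/-!
# Pair annihilators see the charge carriers, II: the hole channel summed and the carrier bound

Continuation of `PairFieldCarrierBoundCore` (same setting and notation: elementary pair
annihilators `T_j = c_{a_j} c_{b_j}`, partner orbitals `o_j`, weights `w_j`, hole weights
`H_j = Σ_{t ∌ a_j, o_j} |ψ t|²`, doublon weights `D_j = Σ_{t ∋ a_j, o_j} |ψ t|²`, and the symmetric
FAR relation `{a_j, b_j} ∩ {a_{j'}, o_{j'}} = ∅ = {a_{j'}, b_{j'}} ∩ {a_j, o_j}`).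

* `sum_norm_sq_holePart_le` — the HOLE channel: if a nonnegative kernel dominating the non-far
  pairs has row/column sums `≤ D`,
  `Σ_s |Σ_j w_j [o_j ∉ s] (T_j ψ)(s)|² ≤ (Σ_j |w_j|²) (Σ_j H_j + D ‖ψ‖²)` (expand the square, bound
  each overlap by part I's `sum_norm_holeTerm_mul_le`, Cauchy–Schwarz in `j` for the far part and
  the degree bound for the near part);
* `sum_norm_sq_pairSum_le_carrier` — **the carrier bound**: for every Fock vector `ψ`,
  `Σ_s |Σ_j w_j (T_j ψ)(s)|² ≤ 2 (Σ_j |w_j|²) (Σ_j D_j + Σ_j H_j + D ‖ψ‖²)`, with the hole / doublon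
  indicators and the near-pair indicator passed as dominating functions (so that users instantiate
  them with their own decidability instances).
  A coherent pair amplitude of size `‖w‖² · X` forces hole or doublon weight of size `X`: this is
  the kinematic kernel of "the pair-field order parameter of a doped Mott insulator is controlled
  by the carrier density" (cf. the Gutzwiller factor `g_t = 2δ/(1+δ)` of renormalised mean-field
  theory, Zhang–Gross–Rice–Shiba, Supercond. Sci. Technol. 1 (1988) 36, §2; Yang, Rev. Mod. Phys.
  34 (1962) 694, §3 for the unconstrained kinematic bound).

Folklore finite-dimensional estimates; no definition and no named fact is introduced.
-/

namespace Literature.MathematicalPhysics.QuantumLattice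

namespace PairFieldCarrier

open Matrix Finset RayleighBound

variable {ι : Type*} [LinearOrder ι] [Fintype ι]

section Assembly

variable {J : Type*} [Fintype J] (a b o : J → ι) (w : J → ℂ) (ψ : Fock ι)

omit [Fintype ι] [Fintype J] in
/-- The "far" relation is symmetric, hence so is the near indicator. [folklore] -/
theorem nearInd_comm (j j' : J) :
    (if (a j ≠ a j' ∧ a j ≠ o j' ∧ b j ≠ a j' ∧ b j ≠ o j') ∧
        (a j' ≠ a j ∧ a j' ≠ o j ∧ b j' ≠ a j ∧ b j' ≠ o j) then (0 : ℝ) else 1) =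
      if (a j' ≠ a j ∧ a j' ≠ o j ∧ b j' ≠ a j ∧ b j' ≠ o j) ∧
        (a j ≠ a j' ∧ a j ≠ o j' ∧ b j ≠ a j' ∧ b j ≠ o j') then (0 : ℝ) else 1 :=
  if_congr and_comm rfl rfl

/-- **Hole channel.** Restricting every term to output configurations NOT containing the partner
orbital `o_j` (so that the site `x_j` is EMPTY in the output `s`): if a nonnegative kernel `nInd`
dominates the indicator of the non-far pairs and has row and column sums at most `D`, then
`Σ_s |Σ_j w_j [o_j ∉ s] (c_{a_j} c_{b_j} ψ)(s)|² ≤ (Σ_j |w_j|²) (Σ_j H_j + D ‖ψ‖²)`,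
`H_j = Σ_{t ∌ a_j, o_j} |ψ t|²` (expand the square, bound each overlap by
`sum_norm_holeTerm_mul_le`, and use Cauchy–Schwarz in `j` for the far part, the degree bound for the
near part). [folklore] -/
theorem sum_norm_sq_holePart_le (hab : ∀ j, a j ≠ b j) {D : ℝ} (nInd : J → J → ℝ)
    (hn0 : ∀ j j', 0 ≤ nInd j j')
    (hn1 : ∀ j j', ¬ ((a j ≠ a j' ∧ a j ≠ o j' ∧ b j ≠ a j' ∧ b j ≠ o j') ∧
        (a j' ≠ a j ∧ a j' ≠ o j ∧ b j' ≠ a j ∧ b j' ≠ o j)) → 1 ≤ nInd j j')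
    (hD : ∀ j, ∑ j', nInd j j' ≤ D) (hD' : ∀ j', ∑ j, nInd j j' ≤ D) :
    (∑ s : Finset ι, ‖∑ j, w j * ((if o j ∉ s then (1 : ℂ) else 0) *
        ((annihilation (a j) * annihilation (b j)) *ᵥ ψ) s)‖ ^ 2) ≤
      (∑ j, ‖w j‖ ^ 2) *
        ((∑ j, ∑ t : Finset ι, if a j ∉ t ∧ o j ∉ t then ‖ψ t‖ ^ 2 else 0) +
          D * ∑ t : Finset ι, ‖ψ t‖ ^ 2) := by
  classical
  -- abbreviations: hole weights, hole-channel terms, near indicator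
  set H : J → ℝ := fun j => ∑ t : Finset ι, if a j ∉ t ∧ o j ∉ t then ‖ψ t‖ ^ 2 else 0 with hH
  set v : J → Finset ι → ℝ := fun j s => ‖(if o j ∉ s then (1 : ℂ) else 0) *
      ((annihilation (a j) * annihilation (b j)) *ᵥ ψ) s‖ with hv
  set nr : J → J → ℝ := fun j j' =>
    if (a j ≠ a j' ∧ a j ≠ o j' ∧ b j ≠ a j' ∧ b j ≠ o j') ∧
        (a j' ≠ a j ∧ a j' ≠ o j ∧ b j' ≠ a j ∧ b j' ≠ o j) then (0 : ℝ) else 1 with hnr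
  set P : ℝ := ∑ t : Finset ι, ‖ψ t‖ ^ 2 with hP
  have hH0 : ∀ j, 0 ≤ H j := fun j => Finset.sum_nonneg fun t _ => by positivity
  have hP0 : 0 ≤ P := Finset.sum_nonneg fun t _ => by positivity
  have hnr0 : ∀ j j', 0 ≤ nr j j' := fun j j' => by simp only [hnr]; split_ifs <;> norm_num
  have hw0 : 0 ≤ ∑ j, ‖w j‖ ^ 2 := Finset.sum_nonneg fun _ _ => by positivity
  -- degree bound in terms of the near indicator: `nr ≤ nInd` pointwise
  have hnrle : ∀ j j', nr j j' ≤ nInd j j' := by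
    intro j j'
    simp only [hnr]
    split_ifs with h
    · exact hn0 j j'
    · exact hn1 j j' h
  have hdeg : ∀ j, ∑ j', nr j j' ≤ D := fun j =>
    (Finset.sum_le_sum fun j' _ => hnrle j j').trans (hD j)
  have hdeg' : ∀ j', ∑ j, nr j j' ≤ D := fun j' =>
    (Finset.sum_le_sum fun j _ => hnrle j j').trans (hD' j')
  -- step 1: expand the square and bound the overlaps
  have step1 : (∑ s : Finset ι, ‖∑ j, w j * ((if o j ∉ s then (1 : ℂ) else 0) *
        ((annihilation (a j) * annihilation (b j)) *ᵥ ψ) s)‖ ^ 2) ≤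
      ∑ j, ∑ j', ‖w j‖ * ‖w j'‖ * (Real.sqrt (H j') * Real.sqrt (H j) + nr j j' * P) := by
    calc (∑ s : Finset ι, ‖∑ j, w j * ((if o j ∉ s then (1 : ℂ) else 0) *
          ((annihilation (a j) * annihilation (b j)) *ᵥ ψ) s)‖ ^ 2)
        ≤ ∑ s : Finset ι, ∑ j, ∑ j', ‖w j‖ * ‖w j'‖ * (v j s * v j' s) := by
          refine Finset.sum_le_sum fun s _ => (norm_sum_sq_le_sum_sum _ _).trans (le_of_eq ?_)
          refine Finset.sum_congr rfl fun j _ => Finset.sum_congr rfl fun j' _ => ?_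
          simp only [hv, norm_mul]
          ring
      _ = ∑ j, ∑ j', ‖w j‖ * ‖w j'‖ * ∑ s : Finset ι, v j s * v j' s := by
          rw [Finset.sum_comm]
          refine Finset.sum_congr rfl fun j _ => ?_
          rw [Finset.sum_comm]
          refine Finset.sum_congr rfl fun j' _ => ?_
          rw [Finset.mul_sum]
      _ ≤ ∑ j, ∑ j', ‖w j‖ * ‖w j'‖ * (Real.sqrt (H j') * Real.sqrt (H j) + nr j j' * P) := by
          refine Finset.sum_le_sum fun j _ => Finset.sum_le_sum fun j' _ => ?_
          refine mul_le_mul_of_nonneg_left ?_ (by positivity)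
          exact sum_norm_holeTerm_mul_le a b o ψ hab j j'
  -- step 2: the far part by Cauchy–Schwarz in `j`
  have step2 : ∑ j, ∑ j', ‖w j‖ * ‖w j'‖ * (Real.sqrt (H j') * Real.sqrt (H j)) ≤
      (∑ j, ‖w j‖ ^ 2) * ∑ j, H j := by
    have hsq : ∀ j, Real.sqrt (H j) ^ 2 = H j := fun j => Real.sq_sqrt (hH0 j)
    calc ∑ j, ∑ j', ‖w j‖ * ‖w j'‖ * (Real.sqrt (H j') * Real.sqrt (H j))
        = (∑ j, ‖w j‖ * Real.sqrt (H j)) * ∑ j', ‖w j'‖ * Real.sqrt (H j') := by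
          rw [Finset.sum_mul_sum]
          refine Finset.sum_congr rfl fun j _ => Finset.sum_congr rfl fun j' _ => ?_
          ring
      _ = (∑ j, ‖w j‖ * Real.sqrt (H j)) ^ 2 := by ring
      _ ≤ (∑ j, ‖w j‖ ^ 2) * ∑ j, Real.sqrt (H j) ^ 2 := Finset.sum_mul_sq_le_sq_mul_sq _ _ _
      _ = (∑ j, ‖w j‖ ^ 2) * ∑ j, H j := by simp only [hsq]
  -- step 3: the near part by the degree bound
  have step3 : ∑ j, ∑ j', ‖w j‖ * ‖w j'‖ * (nr j j' * P) ≤ (∑ j, ‖w j‖ ^ 2) * (D * P) := by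
    have hyoung : ∀ j j', ‖w j‖ * ‖w j'‖ * (nr j j' * P) ≤
        (‖w j‖ ^ 2 * nr j j' + ‖w j'‖ ^ 2 * nr j j') / 2 * P := by
      intro j j'
      have h1 : ‖w j‖ * ‖w j'‖ ≤ (‖w j‖ ^ 2 + ‖w j'‖ ^ 2) / 2 := by
        nlinarith [sq_nonneg (‖w j‖ - ‖w j'‖)]
      have := mul_le_mul_of_nonneg_right h1 (mul_nonneg (hnr0 j j') hP0)
      nlinarith [this]
    calc ∑ j, ∑ j', ‖w j‖ * ‖w j'‖ * (nr j j' * P)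
        ≤ ∑ j, ∑ j', (‖w j‖ ^ 2 * nr j j' + ‖w j'‖ ^ 2 * nr j j') / 2 * P :=
          Finset.sum_le_sum fun j _ => Finset.sum_le_sum fun j' _ => hyoung j j'
      _ = ((∑ j, ∑ j', ‖w j‖ ^ 2 * nr j j') + ∑ j, ∑ j', ‖w j'‖ ^ 2 * nr j j') / 2 * P := by
          rw [← Finset.sum_add_distrib, Finset.sum_div, Finset.sum_mul]
          refine Finset.sum_congr rfl fun j _ => ?_
          rw [← Finset.sum_add_distrib, Finset.sum_div, Finset.sum_mul]
      _ = ((∑ j, ‖w j‖ ^ 2 * ∑ j', nr j j') + ∑ j', (‖w j'‖ ^ 2 * ∑ j, nr j j')) / 2 * P := by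
          have h1 : (∑ j, ∑ j', ‖w j‖ ^ 2 * nr j j') = ∑ j, (‖w j‖ ^ 2 * ∑ j', nr j j') :=
            Finset.sum_congr rfl fun j _ => by rw [Finset.mul_sum]
          have h2 : (∑ j, ∑ j', ‖w j'‖ ^ 2 * nr j j') = ∑ j', (‖w j'‖ ^ 2 * ∑ j, nr j j') := by
            rw [Finset.sum_comm]
            exact Finset.sum_congr rfl fun j' _ => by rw [Finset.mul_sum]
          rw [h1, h2]
      _ ≤ ((∑ j, (‖w j‖ ^ 2 * D)) + ∑ j', (‖w j'‖ ^ 2 * D)) / 2 * P := by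
          refine mul_le_mul_of_nonneg_right ?_ hP0
          refine div_le_div_of_nonneg_right (add_le_add ?_ ?_) (by norm_num)
          · exact Finset.sum_le_sum fun j _ => mul_le_mul_of_nonneg_left (hdeg j) (by positivity)
          · exact Finset.sum_le_sum fun j' _ => mul_le_mul_of_nonneg_left (hdeg' j') (by positivity)
      _ = (∑ j, ‖w j‖ ^ 2) * (D * P) := by
          rw [← Finset.sum_mul]
          ring
  -- combine
  calc (∑ s : Finset ι, ‖∑ j, w j * ((if o j ∉ s then (1 : ℂ) else 0) *
        ((annihilation (a j) * annihilation (b j)) *ᵥ ψ) s)‖ ^ 2)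
      ≤ ∑ j, ∑ j', ‖w j‖ * ‖w j'‖ * (Real.sqrt (H j') * Real.sqrt (H j) + nr j j' * P) := step1
    _ = (∑ j, ∑ j', ‖w j‖ * ‖w j'‖ * (Real.sqrt (H j') * Real.sqrt (H j))) +
          ∑ j, ∑ j', ‖w j‖ * ‖w j'‖ * (nr j j' * P) := by
        rw [← Finset.sum_add_distrib]
        refine Finset.sum_congr rfl fun j _ => ?_
        rw [← Finset.sum_add_distrib]
        refine Finset.sum_congr rfl fun j' _ => ?_
        ring
    _ ≤ (∑ j, ‖w j‖ ^ 2) * ∑ j, H j + (∑ j, ‖w j‖ ^ 2) * (D * P) := add_le_add step2 step3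
    _ = (∑ j, ‖w j‖ ^ 2) * ((∑ j, H j) + D * P) := by ring

omit [Fintype ι] [Fintype J] in
/-- Splitting a term into its two channels. [folklore] -/
theorem pairTerm_eq_holePart_add_doublonPart (j : J) (s : Finset ι) (z : ℂ) :
    w j * z = w j * ((if o j ∉ s then (1 : ℂ) else 0) * z) + w j * ((if o j ∈ s then (1 : ℂ) else 0) * z) := by
  by_cases h : o j ∈ s <;> simp [h]

/-- **The carrier bound.** For a finite family of elementary pair annihilators `c_{a_j} c_{b_j}`
(`a_j ≠ b_j`) with partner orbitals `o_j` and weights `w_j`, let `dInd_j, hInd_j ≥ 0` dominate the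
doublon indicator `[a_j, o_j ∈ t]` and the hole indicator `[a_j, o_j ∉ t]`, and let a nonnegative
kernel `nInd` dominate the indicator of non-far pairs, with row and column sums at most `D`. Then
every Fock vector `ψ` satisfies
`Σ_s |Σ_j w_j (c_{a_j} c_{b_j} ψ)(s)|² ≤ 2 (Σ_j |w_j|²) (Σ_j Σ_t dInd_j(t) |ψ t|² + Σ_j Σ_t hInd_j(t) |ψ t|² + D ‖ψ‖²)`:
a coherent pair amplitude needs holes or doubly occupied sites. (The indicators are passed as
dominating functions so that users instantiate them with their own decidability instances.) [folklore] -/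
theorem sum_norm_sq_pairSum_le_carrier (hab : ∀ j, a j ≠ b j) {D : ℝ}
    (dInd hInd : J → Finset ι → ℝ) (nInd : J → J → ℝ)
    (hd0 : ∀ j t, 0 ≤ dInd j t) (hd1 : ∀ j t, a j ∈ t → o j ∈ t → 1 ≤ dInd j t)
    (hh0 : ∀ j t, 0 ≤ hInd j t) (hh1 : ∀ j t, a j ∉ t → o j ∉ t → 1 ≤ hInd j t)
    (hn0 : ∀ j j', 0 ≤ nInd j j')
    (hn1 : ∀ j j', ¬ ((a j ≠ a j' ∧ a j ≠ o j' ∧ b j ≠ a j' ∧ b j ≠ o j') ∧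
        (a j' ≠ a j ∧ a j' ≠ o j ∧ b j' ≠ a j ∧ b j' ≠ o j)) → 1 ≤ nInd j j')
    (hD : ∀ j, ∑ j', nInd j j' ≤ D) (hD' : ∀ j', ∑ j, nInd j j' ≤ D) :
    (∑ s : Finset ι, ‖∑ j, w j * ((annihilation (a j) * annihilation (b j)) *ᵥ ψ) s‖ ^ 2) ≤
      2 * (∑ j, ‖w j‖ ^ 2) *
        ((∑ j, ∑ t : Finset ι, dInd j t * ‖ψ t‖ ^ 2) +
          (∑ j, ∑ t : Finset ι, hInd j t * ‖ψ t‖ ^ 2) +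
          D * ∑ t : Finset ι, ‖ψ t‖ ^ 2) := by
  classical
  have hsplit : ∀ s : Finset ι,
      ∑ j, w j * ((annihilation (a j) * annihilation (b j)) *ᵥ ψ) s =
        (∑ j, w j * ((if o j ∉ s then (1 : ℂ) else 0) *
          ((annihilation (a j) * annihilation (b j)) *ᵥ ψ) s)) +
        ∑ j, w j * ((if o j ∈ s then (1 : ℂ) else 0) *
          ((annihilation (a j) * annihilation (b j)) *ᵥ ψ) s) := by
    intro s
    rw [← Finset.sum_add_distrib]
    exact Finset.sum_congr rfl fun j _ => pairTerm_eq_holePart_add_doublonPart o w j s _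
  have hh := sum_norm_sq_holePart_le a b o w ψ hab nInd hn0 hn1 hD hD'
  have hd := sum_norm_sq_doublonPart_le a b o w ψ hab
  have hw0 : 0 ≤ ∑ j, ‖w j‖ ^ 2 := Finset.sum_nonneg fun _ _ => by positivity
  -- indicator sums are dominated by the `dInd` / `hInd` sums
  have hdle : (∑ j, ∑ t : Finset ι, if a j ∈ t ∧ o j ∈ t then ‖ψ t‖ ^ 2 else 0) ≤
      ∑ j, ∑ t : Finset ι, dInd j t * ‖ψ t‖ ^ 2 := by
    refine Finset.sum_le_sum fun j _ => Finset.sum_le_sum fun t _ => ?_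
    split_ifs with h
    · have := hd1 j t h.1 h.2
      nlinarith [sq_nonneg ‖ψ t‖]
    · exact mul_nonneg (hd0 j t) (by positivity)
  have hhle : (∑ j, ∑ t : Finset ι, if a j ∉ t ∧ o j ∉ t then ‖ψ t‖ ^ 2 else 0) ≤
      ∑ j, ∑ t : Finset ι, hInd j t * ‖ψ t‖ ^ 2 := by
    refine Finset.sum_le_sum fun j _ => Finset.sum_le_sum fun t _ => ?_
    split_ifs with h
    · have := hh1 j t h.1 h.2
      nlinarith [sq_nonneg ‖ψ t‖]
    · exact mul_nonneg (hh0 j t) (by positivity)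
  calc (∑ s : Finset ι, ‖∑ j, w j * ((annihilation (a j) * annihilation (b j)) *ᵥ ψ) s‖ ^ 2)
      ≤ ∑ s : Finset ι, (2 * ‖∑ j, w j * ((if o j ∉ s then (1 : ℂ) else 0) *
            ((annihilation (a j) * annihilation (b j)) *ᵥ ψ) s)‖ ^ 2 +
          2 * ‖∑ j, w j * ((if o j ∈ s then (1 : ℂ) else 0) *
            ((annihilation (a j) * annihilation (b j)) *ᵥ ψ) s)‖ ^ 2) := by
        refine Finset.sum_le_sum fun s _ => ?_
        rw [hsplit s]
        -- `‖u + v‖² ≤ 2‖u‖² + 2‖v‖²`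
        have hpar : ∀ u v : ℂ, ‖u + v‖ ^ 2 ≤ 2 * ‖u‖ ^ 2 + 2 * ‖v‖ ^ 2 := fun u v => by
          nlinarith [norm_add_le u v, norm_nonneg (u + v), sq_nonneg (‖u‖ - ‖v‖),
            norm_nonneg u, norm_nonneg v]
        exact hpar _ _
    _ = 2 * (∑ s : Finset ι, ‖∑ j, w j * ((if o j ∉ s then (1 : ℂ) else 0) *
            ((annihilation (a j) * annihilation (b j)) *ᵥ ψ) s)‖ ^ 2) +
          2 * ∑ s : Finset ι, ‖∑ j, w j * ((if o j ∈ s then (1 : ℂ) else 0) *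
            ((annihilation (a j) * annihilation (b j)) *ᵥ ψ) s)‖ ^ 2 := by
        rw [Finset.sum_add_distrib, Finset.mul_sum, Finset.mul_sum]
    _ ≤ 2 * ((∑ j, ‖w j‖ ^ 2) * ((∑ j, ∑ t : Finset ι, if a j ∉ t ∧ o j ∉ t then ‖ψ t‖ ^ 2 else 0) +
          D * ∑ t : Finset ι, ‖ψ t‖ ^ 2)) +
          2 * ((∑ j, ‖w j‖ ^ 2) *
            ∑ j, ∑ t : Finset ι, if a j ∈ t ∧ o j ∈ t then ‖ψ t‖ ^ 2 else 0) := by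
        gcongr
    _ ≤ 2 * ((∑ j, ‖w j‖ ^ 2) * ((∑ j, ∑ t : Finset ι, hInd j t * ‖ψ t‖ ^ 2) +
          D * ∑ t : Finset ι, ‖ψ t‖ ^ 2)) +
          2 * ((∑ j, ‖w j‖ ^ 2) * ∑ j, ∑ t : Finset ι, dInd j t * ‖ψ t‖ ^ 2) := by
        gcongr
    _ = _ := by ring

end Assembly

end PairFieldCarrier

end Literature.MathematicalPhysics.QuantumLattice
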